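import Literature.IUT.LogVolume.MultiradialRegion
import HarnessLib

/-!
# (Ind1) and the hull of the union: every slot's theta value bounds the log-volume of `hull(U_Θ)` from
# below, summand by summand (Dupuy–Hilado §4.7, §4.11–4.12; the locus of [IUTchIV] Thm. 1.10 Step (v))

PROOF-ONLY consumer of `MultiradialRegion.lean` (abc-iut-c312-3's `IndPacketModel`: the (Ind1) transport
`perm` along a permutation of the tensor slots, the (Ind2) groups, the (Ind3) datum, `U_Θ` and its hull —
Dupuy–Hilado, *The statement of Mochizuki's Corollary 3.12…*, arXiv:2004.13228, §4.7 "if `f_j` … is the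
underlying permutation of the `j`th capsule … then on the summand `K_{v̲_0} ⊗ ⋯ ⊗ K_{v̲_j}` we have
`K_{v̲_0} ⊗ ⋯ ⊗ K_{v̲_j} → K_{v̲_{f_j⁻¹(0)}} ⊗ ⋯ ⊗ K_{v̲_{f_j⁻¹(j)}}`", §4.11 "`U_Θ := Ind2(Ind1((O_𝕃(−P_Θ))^{Ind3}))`",
§4.12 "the smallest polydisc containing `Ω`"). Written by the wave-3 discharge seat abc-iut-c312-d1.

WHAT IS PROVED (elementary consequences of those definitions, no new hypothesis on the model):
* `perm_image_region_subset_UThetaUnion` — for EVERY permutation `σ` of the slots of the summand `v⃗`, the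
  (Ind1)-transport to `v⃗` of the bare Θ-region of the PERMUTED summand `v⃗ ∘ σ` lies in the `v⃗`-component of
  `U_Θ` (take the (Ind2)-element `1` and the (Ind1)-element that is `σ` in degree `j` and `1` elsewhere; the
  bare region lies in its (Ind3)-enlargement, `Ind3Datum.region_subset`).
* `lnAbs_le_logμ_hullUTheta` — hence, whenever the `v⃗`-component of `hull(U_Θ)` is admissible, its
  normalised log-measure is AT LEAST `ln|t_{j,v}|_p` for the theta value `t_{j,v}` at the place `v = v⃗(σ(j))`
  sitting in ANY slot (`logμ_perm`: the transport preserves the log-measure; `logμ_peel_O`: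
  `log μ̄(t·O) = ln|t|_p`; hull and measure monotonicity) — `lnAbs_le_logμ_hullUTheta_of_slot`: for every slot
  `k` of `v⃗`, `ln|t_{j,v⃗(k)}|_p ≤ log μ̄_{v⃗}(hull(U_Θ)_{v⃗})`.
* `le_of_logμ_hullUTheta_le` — so ANY upper bound `B` for `log μ̄_{v⃗}(hull(U_Θ)_{v⃗})` satisfies
  `ln|t_{j,v⃗(k)}|_p ≤ B` for every slot `k`: a per-collection bound is governed by the LEAST divisible theta
  value occurring in the collection (`−min_k ord`), not by the value in the distinguished last slot alone and
  not by the average over the slots.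

WHY IT IS RECORDED. [IUTchIV] Thm. 1.10, proof, Step (v) (kurims Apr-2020 ms p. 27–28) bounds "the component
of the log-volume … corresponding to the tensor product … associated to this collection `{v_i}_{i∈S±_{j+1}}`"
using "`λ`" := `ord(q_{v_j}^{j²})` of the LAST index `i† = j` and then states: "unlike the other terms …, "`λ`"
is asymmetric with respect to the choice of "`i† ∈ I`" … after symmetrizing with respect to the choice of
"`i† ∈ I`" in `S±_{j+1}`, this upper bound may be written in the form "`β_e`" … it follows immediately from the
first equality of the first display of Proposition 1.7 that, after passing to weighted averages, the operation
of symmetrizing … does not affect the computation of the upper bound under consideration" — the symmetrized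
`β_e` carries the AVERAGE `(1/(j+1))·Σ_i ord(q_{v_i}^{j²})`. The cell's campaign-S file
`Theorem110LocalBounds.lean` (abc-iut-S3) types the per-collection bound `DstLocal.collBound` with the
last-slot value `logQ (e (Fin.last j))` and takes the per-collection inequality as the hypothesis `hvol` of
`hull_bound_of_local_bounds`. The theorems below show, at the level of the typed definitions of `U_Θ`, what
any such per-collection bound must dominate. When all places of the collection carry theta values of the
same size (e.g. `F_mod = ℚ`, one place over each `p` — the case of the summit `ABC`), minimum, last slot and
average coincide and nothing is lost. See HOME/plan/c312/STEPV-IND1-NOTE.md for the prose audit note.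
[cite: DupuyHilado2025, §4.7, §4.11, §4.12] Nothing here takes a side on [IUTchIII] Cor. 3.12 or asserts
anything about [IUTchIV] Thm. 1.10 beyond the displayed consequences of the typed definitions; typed ≠ endorsed.
-/

noncomputable section

namespace Literature.IUT.LogVolume

namespace IndPacketModel

open Set
open scoped Pointwise

variable {F : Type*} [Field F] [NumberField F] (M : IndPacketModel F)
variable {lstar : ℕ} {t : M.LgpIdele lstar} (D : M.Ind3Datum t)

/-- The global (Ind1)-element which is the permutation `σ` in tensor degree `j` and the identity in every
other degree. Stated as a term inside proofs only (`Function.update`); this lemma records its value at `j`.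
[cite: DupuyHilado2025, §4.7] -/
theorem update_one_apply_self (j : ℕ) (σ : Equiv.Perm (Fin (j + 1))) :
    Function.update (1 : M.Ind1Elt) j σ j = σ := by
  simp

/-- For every GLOBAL (Ind1)-element `σ` (one permutation per tensor degree), the (Ind1)-transport to `v⃗` of
the bare Θ-region of the permuted summand `v⃗ ∘ σ_j` lies in the `v⃗`-component of `U_Θ` (with the
(Ind2)-element `1`; the bare region lies in its (Ind3)-enlargement, `Ind3Datum.region_subset`).
[cite: DupuyHilado2025, §4.7, §4.11] -/
theorem ind1_image_region_subset_UThetaUnion (σ : M.Ind1Elt) (p j : ℕ)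
    (e : Fin (j + 1) → placesOver F p) :
    M.perm (σ j) e '' M.region t p j (e ∘ σ j) ⊆ M.UThetaUnion D p j e := by
  intro x hx
  refine Set.mem_iUnion.mpr ⟨((fun _ _ _ => 1), σ), ?_⟩
  show x ∈ (1 : M.G₂ p j e) • (M.perm (σ j) e '' D.bare3 p j (e ∘ σ j))
  exact Set.mem_smul_set.mpr ⟨x, Set.image_mono (D.region_subset p j (e ∘ σ j)) hx, one_smul _ x⟩

/-- **Every permuted bare region is a possible image.** For every permutation `σ` of the slots of the
summand `v⃗`, the (Ind1)-transport to `v⃗` of the bare Θ-region `O_𝕃(−P_Θ)_{v⃗∘σ}` of the permuted summand lies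
in the `v⃗`-component of `U_Θ = Ind2(Ind1((O_𝕃(−P_Θ))^{Ind3}))` (use the global (Ind1)-element that is `σ` in
degree `j` and the identity in every other degree). [cite: DupuyHilado2025, §4.7, §4.11] -/
theorem perm_image_region_subset_UThetaUnion (p j : ℕ) (e : Fin (j + 1) → placesOver F p)
    (σ : Equiv.Perm (Fin (j + 1))) :
    M.perm σ e '' M.region t p j (e ∘ σ) ⊆ M.UThetaUnion D p j e := by
  have h := M.ind1_image_region_subset_UThetaUnion D (Function.update (1 : M.Ind1Elt) j σ) p j e
  rwa [M.update_one_apply_self] at h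

/-- … hence it lies in the `v⃗`-component of `hull(U_Θ)`. [cite: DupuyHilado2025, §4.11, §4.12] -/
theorem perm_image_region_subset_hullUTheta (p j : ℕ) (e : Fin (j + 1) → placesOver F p)
    (σ : Equiv.Perm (Fin (j + 1))) :
    M.perm σ e '' M.region t p j (e ∘ σ) ⊆ M.hullUTheta D p j e :=
  (M.perm_image_region_subset_UThetaUnion D p j e σ).trans (M.le_hull (M.UThetaUnion D) p j e)

/-- The transported bare region is admissible. [cite: DupuyHilado2025, §4.7] -/
theorem perm_image_region_adm (p j : ℕ) (e : Fin (j + 1) → placesOver F p)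
    (σ : Equiv.Perm (Fin (j + 1))) : M.adm (M.perm σ e '' M.region t p j (e ∘ σ)) :=
  M.perm_adm σ e (M.region_adm t p j (e ∘ σ))

/-- The transported bare region has the log-measure `ln|t_{j,v}|_p` of the theta value at the place
`v = v⃗(σ(j))` that the permutation puts in the distinguished (last) slot (`logμ_perm`, `logμ_peel_O`).
[cite: DupuyHilado2025, §3.9, §4.7] -/
theorem logμ_perm_image_region (p : ℕ) (i : Fin lstar) (e : Fin ((i : ℕ) + 1 + 1) → placesOver F p)
    (σ : Equiv.Perm (Fin ((i : ℕ) + 1 + 1))) :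
    M.logμ (M.perm σ e '' M.region t p ((i : ℕ) + 1) (e ∘ σ)) = M.lnAbs (t i p (e (σ (Fin.last _)))) := by
  rw [M.logμ_perm σ e (M.region_adm t p _ (e ∘ σ)), M.region_succ t i p (e ∘ σ)]
  exact M.logμ_peel_O (t i p ((e ∘ σ) (Fin.last _)))

/-- **Lower bound for the hull of the union, from any permutation.** If the `v⃗`-component of `hull(U_Θ)` is
admissible (as in every use: its log-volume is the `v⃗`-contribution to `−|log(Θ)|`), then for every
permutation `σ` of the slots, `ln|t_{j, v⃗(σ(j))}|_p ≤ log μ̄_{v⃗}(hull(U_Θ)_{v⃗})` (degree `j = i+1`).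
[cite: DupuyHilado2025, §4.11, §4.12] -/
theorem lnAbs_le_logμ_hullUTheta (p : ℕ) (i : Fin lstar) (e : Fin ((i : ℕ) + 1 + 1) → placesOver F p)
    (σ : Equiv.Perm (Fin ((i : ℕ) + 1 + 1))) (hH : M.adm (M.hullUTheta D p ((i : ℕ) + 1) e)) :
    M.lnAbs (t i p (e (σ (Fin.last _)))) ≤ M.logμ (M.hullUTheta D p ((i : ℕ) + 1) e) := by
  rw [← M.logμ_perm_image_region p i e σ]
  exact M.logμ_mono (M.perm_image_region_adm p _ e σ) hH
    (M.perm_image_region_subset_hullUTheta D p _ e σ)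

/-- **Every slot counts.** For every slot `k` of the summand `v⃗` (degree `j = i+1`), the theta value at the
place `v⃗(k)` bounds the log-measure of the `v⃗`-component of `hull(U_Θ)` from below:
`ln|t_{j,v⃗(k)}|_p ≤ log μ̄_{v⃗}(hull(U_Θ)_{v⃗})` — the (Ind1)-element swapping `k` with the last slot puts
`v⃗(k)` in the distinguished position. Consequently `log μ̄_{v⃗}(hull(U_Θ)_{v⃗}) ≥ max_k ln|t_{j,v⃗(k)}|_p`: the
hull of the UNION over (Ind1) is governed by the least divisible theta value in the collection.
[cite: DupuyHilado2025, §4.7, §4.11, §4.12] -/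
theorem lnAbs_le_logμ_hullUTheta_of_slot (p : ℕ) (i : Fin lstar) (e : Fin ((i : ℕ) + 1 + 1) → placesOver F p)
    (k : Fin ((i : ℕ) + 1 + 1)) (hH : M.adm (M.hullUTheta D p ((i : ℕ) + 1) e)) :
    M.lnAbs (t i p (e k)) ≤ M.logμ (M.hullUTheta D p ((i : ℕ) + 1) e) := by
  have h := M.lnAbs_le_logμ_hullUTheta D p i e (Equiv.swap k (Fin.last _)) hH
  rwa [Equiv.swap_apply_right] at h

/-- **What any per-collection upper bound must dominate.** If `B` bounds the log-measure of the
`v⃗`-component of `hull(U_Θ)` from above, then `ln|t_{j,v⃗(k)}|_p ≤ B` for EVERY slot `k` — in particular a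
bound whose only dependence on the theta values is through the last slot `v⃗(j)`, or through the average over
the slots, can hold for all collections only if it also dominates the least divisible value in each collection.
(For constant collections — one place over `p`, e.g. `F_mod = ℚ` — the three coincide.)
[cite: DupuyHilado2025, §4.11, §4.12] -/
theorem le_of_logμ_hullUTheta_le (p : ℕ) (i : Fin lstar) (e : Fin ((i : ℕ) + 1 + 1) → placesOver F p)
    (hH : M.adm (M.hullUTheta D p ((i : ℕ) + 1) e)) {B : ℝ}
    (hB : M.logμ (M.hullUTheta D p ((i : ℕ) + 1) e) ≤ B) (k : Fin ((i : ℕ) + 1 + 1)) :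
    M.lnAbs (t i p (e k)) ≤ B :=
  (M.lnAbs_le_logμ_hullUTheta_of_slot D p i e k hH).trans hB

end IndPacketModel

end Literature.IUT.LogVolume

end
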